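import Literature.Analysis.FluidPDE.PlanarTypedChain
import Literature.Analysis.FluidPDE.PlanarPullbackTransport
import Literature.Analysis.FluidPDE.QuasiSelfSimilarGeneratorPhases
import HarnessLib

/-!
# The gate template of a typed chain: rational gate checks and the generator-move package

Topic `Literature/Analysis/FluidPDE`. Level-4 data model, part 7 (gate side; imports only `PlanarTypedChain.lean`).
A phase `P : PhaseQ` of an explicit generating move (ACM 2019, §8.9–8.11) must, besides the interior
facts of `PlanarChainCover.lean` / `PlanarJunctionAgreement.lean`, satisfy the GATE clauses of
`QuasiSelfSimilar.IsGeneratorMoveOn` (`QuasiSelfSimilarGeneratorPhases.lean`): on the `δ`-strips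
along the four faces the fields vanish away from the gate windows, inside the gate windows they are
the universal gate fields placed at the gate, and the velocity is tangent to the faces (ACM 2019,
§8.4 (a)–(c), §8.6: "near every crossed side the field is the canonical field of the straight line
through the midpoint"). This file provides:

* `GateC` — the **gate template datum** shared by all phases of both generators: the squeeze clock
  `(t₀, τ)`, the clock-affine slope schedule `W` of the gate stubs, the transversal half-extent `th`
  and transition length `ρ` of the stub boxes, the margin `δ`; and the **template fields**
  `GateC.ΘgT C G k`, `GateC.VgT C k` (`k` the axis of the gate face; gate-local coordinates), in
  closed form: `Θ = p(ζ_⊥) G(ζ_⊥ / W(t))`, `V = ∇⊥(p(ζ_⊥) Ψ)`, `Ψ = ∓(W'/W)(t) ζ₀ ζ₁` (the fields of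
  a straight stub squeezed by the schedule, cut off transversally by the plateau `p` of the stub
  box) — with `VgT_eq_perpGrad`, tangency `VgT_tangent`, vanishing at transversal offset `≥ δ`
  (`template_vanish`) and **equivariance** under the symmetries of the square for an even profile
  (`isEquivariantGateField_template`, via `IsEquivariantGateField.of_parity`);
* the **rational gate test** `PhaseQ.gateOKB P C stub a` of a phase against the template on a time
  slot starting at `a`, for a stub table `stub : Fin 2 → Bool → Option ℕ` (node index of the stub at
  each gate face): per face, every non-stub support box avoids the face strip at both clock
  endpoints (`BoxQ.avoidStripB`); the stub box has the template's transversal edges and transition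
  length and a normal plateau equal to `1` on the window (`BoxQ.stubBoxB`); the stub element is a
  run in the inward frame of the face with transverse line `1/2`, no stream offset, no flux through
  the face, all kinks beyond the window, and base slope on the template schedule — the squeeze
  clock itself, or the static final slope on a slot after the squeeze (`RunQ.frameOKB`, `gapOKB`,
  `schedB`); and the neighbouring junction steps are saturated on the window (`StepQ.outStepB`,
  `inStepB`). All decidable by `decide +kernel` on emitted data;
* **soundness**: `PhaseQ.vanish_of_gateOKB`, `PhaseQ.eq_gate_of_gateOKB`, `PhaseQ.tangent_of_gateOKB`
  (through the single-active-term form of the assembly, `assembled_single` /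
  `assembledVelocity_single`, and the closed forms of a stub run on the face strip,
  `RunQ.stub_fields`), relative to the diagonal well-formedness `P.chain.WFBd P.Band` and the
  validity `P.elemsValidB` of the phase (both consequences of the geometric checks of
  `PlanarChainCover.lean`); the package with the interior facts — a checked phase IS an
  `IsGeneratorMoveOn` on `[a, ∞)` — is assembled in the sequel (`PlanarGeneratorAssembly.lean`).

Folklore (explicit Eulerian kinematics and bookkeeping); no named facts. Infrastructure towards a
discharge of `acm_compatible_blocks` (`QuasiSelfSimilarCompatibleBlocks.lean`).

## References

* G. Alberti, G. Crippa, A. L. Mazzucato, *Exponential self-similar mixing by incompressible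
  flows*, J. Amer. Math. Soc. 32 (2019), 445–490, §8.4 (a)–(c), §8.6, §8.9 (arXiv:1605.02090).
-/

noncomputable section

open Function Set Filter
open scoped Topology ContDiff

namespace Literature.Analysis.FluidPDE

namespace PlanarKinematics

open Gluing QuasiSelfSimilar

/-- The plane `ℝ²` as a Euclidean space. [folklore] -/
local notation "E²" => EuclideanSpace ℝ (Fin 2)

/-! ## A single active term of the assembly -/

section Single

variable {K : ℕ} {χ Θ H : ℕ → ℝ → E² → ℝ}

/-- **One active cut-off**: where all cut-offs but `χ_k` vanish, the assembled scalar is `χ_k Θ_k`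
and the assembled stream function (reference stream `0`) is `χ_k H_k`. [folklore] -/
theorem assembled_single {k : ℕ} (hk : k < K) {t : ℝ} {z : E²} (h0 : ∀ j < K, j ≠ k → χ j t z = 0) :
    assembledScalar K χ Θ t z = χ k t z * Θ k t z ∧ assembledStream K 0 χ H t z = χ k t z * H k t z := by
  rw [assembledScalar_apply, assembledStream_apply]
  have hk' : k ∈ Finset.range K := Finset.mem_range.2 hk
  constructor
  · rw [Finset.sum_eq_single_of_mem k hk' fun j hj hjk => by rw [h0 j (Finset.mem_range.1 hj) hjk, zero_mul]]
  · rw [zero_add, Finset.sum_eq_single_of_mem k hk' fun j hj hjk => by rw [h0 j (Finset.mem_range.1 hj) hjk, zero_mul],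
      sub_zero]

/-- **One active cut-off, velocity**: where all cut-offs but `χ_k` vanish near `(t, z)`, the
assembled velocity at `(t, z)` is `∇⊥(χ_k H_k)(t, ·)` at `z`. [folklore] -/
theorem assembledVelocity_single {k : ℕ} (hk : k < K) {t : ℝ} {z : E²}
    (h0 : ∀ᶠ p in 𝓝 (t, z), ∀ j < K, j ≠ k → χ j p.1 p.2 = 0) :
    assembledVelocity K 0 χ H t z = perpGrad (fun w => χ k t w * H k t w) z := by
  rw [assembledVelocity_apply]
  apply perpGrad_congr
  have h1 : ∀ᶠ p in 𝓝 (t, z), assembledStream K 0 χ H p.1 p.2 = χ k p.1 p.2 * H k p.1 p.2 :=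
    h0.mono fun p hp => (assembled_single (Θ := H) hk hp).2
  exact eventually_slice (P := fun s w => assembledStream K 0 χ H s w = χ k s w * H k s w) h1

end Single

/-- **Translation of the argument commutes with `∇⊥`.** [folklore] -/
theorem perpGrad_comp_sub (F : E² → ℝ) (m z : E²) : perpGrad (fun w => F (w - m)) z = perpGrad F (z - m) := by
  rw [perpGrad_apply, perpGrad_apply]
  rw [fderiv_comp_sub]

/-! ## The gate template -/

/-- **Gate template datum** (shared by all phases of both generating moves): the clock `(t₀, τ)`
of the gate squeeze, the clock-affine slope schedule `W` of the gate stubs (the width of the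
channel at the gates goes from `W.v0` to `W.v1` during the squeeze and is static afterwards), the
transversal half-extent `th` and the transition length `ρ` of the stub boxes, and the gate margin
`δ`. [folklore] -/
structure GateC where
  /-- start of the squeeze clock window -/
  t₀ : ℚ
  /-- length of the squeeze clock window -/
  τ : ℚ
  /-- slope schedule of the stubs -/
  W : Aff
  /-- transversal half-extent of the stub boxes -/
  th : ℚ
  /-- transition length of the stub boxes -/
  ρ : ℚ
  /-- gate margin -/
  δ : ℚ
deriving DecidableEq, Inhabited

namespace GateC

variable (C : GateC)

/-- **Validity of a gate template datum**: positive clock length, positive slopes, positive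
transition length, and the transversal support of the stub boxes inside the `δ`-window. [folklore] -/
def validB : Bool :=
  decide (0 < C.τ) && Aff.ltB (Aff.const 0) C.W && decide (0 < C.ρ) && decide (0 < C.δ) &&
    decide (C.th - C.ρ / 3 < C.δ)

/-- The transversal plateau of the template. [folklore] -/
def pT (x : ℝ) : ℝ := plateau (-(C.th : ℝ)) C.th C.ρ x

/-- The slope of the stubs at time `t`. [folklore] -/
def Wt (t : ℝ) : ℝ := C.W.eval (clock C.t₀ C.τ t)

/-- The logarithmic rate `W'/W` of the stubs at time `t`. [folklore] -/
def rt (t : ℝ) : ℝ := clockDeriv C.t₀ C.τ t * C.W.rate / C.Wt t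

/-- **Template stream function** at the gates of axis `k` (gate-local coordinates: the face is
`{ζ_k = 0}`, the gate midpoint is `0`): `∓ (W'/W) ζ₀ ζ₁` cut off transversally. [folklore] -/
def HgT (k : Fin 2) (t : ℝ) (ζ : E²) : ℝ :=
  if k = 0 then -C.rt t * ζ 0 * ζ 1 * C.pT (ζ 1) else C.rt t * ζ 0 * ζ 1 * C.pT (ζ 0)

/-- **Template velocity** at the gates of axis `k`: the perpendicular gradient of `HgT`, in closed
form. [folklore] -/
def VgT (k : Fin 2) (t : ℝ) (ζ : E²) : E² :=
  if k = 0 then vec2 (-C.rt t * ζ 0 * (C.pT (ζ 1) + ζ 1 * deriv C.pT (ζ 1))) (C.rt t * ζ 1 * C.pT (ζ 1))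
  else vec2 (C.rt t * ζ 0 * C.pT (ζ 0)) (-C.rt t * ζ 1 * (C.pT (ζ 0) + ζ 0 * deriv C.pT (ζ 0)))

/-- **Template scalar** at the gates of axis `k` (profile `G`): `G(ζ_⊥ / W(t))` cut off
transversally. [folklore] -/
def ΘgT (G : ℝ → ℝ) (k : Fin 2) (t : ℝ) (ζ : E²) : ℝ :=
  if k = 0 then C.pT (ζ 1) * G (ζ 1 / C.Wt t) else C.pT (ζ 0) * G (ζ 0 / C.Wt t)

variable {C}

/-! ### Consequences of validity -/

/-- The clock length of a valid datum is positive. [folklore] -/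
theorem τ_pos (h : C.validB = true) : (0 : ℝ) < C.τ := by
  simp only [validB, Bool.and_eq_true, decide_eq_true_eq] at h; exact_mod_cast h.1.1.1.1

/-- The transition length of a valid datum is positive. [folklore] -/
theorem ρ_pos (h : C.validB = true) : (0 : ℝ) < C.ρ := by
  simp only [validB, Bool.and_eq_true, decide_eq_true_eq] at h; exact_mod_cast h.1.1.2

/-- The margin of a valid datum is positive. [folklore] -/
theorem δ_pos (h : C.validB = true) : (0 : ℝ) < C.δ := by
  simp only [validB, Bool.and_eq_true, decide_eq_true_eq] at h; exact_mod_cast h.1.2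

/-- The transversal support of the stub boxes of a valid datum lies inside the `δ`-window. [folklore] -/
theorem th_lt (h : C.validB = true) : (C.th : ℝ) - C.ρ / 3 < C.δ := by
  simp only [validB, Bool.and_eq_true, decide_eq_true_eq] at h; exact_mod_cast h.2

/-- The slope schedule of a valid datum is positive at both ends. [folklore] -/
theorem W_ltB (h : C.validB = true) : Aff.ltB (Aff.const 0) C.W = true := by
  simp only [validB, Bool.and_eq_true, decide_eq_true_eq] at h; exact h.1.1.1.2

/-- The slope of the stubs is positive at all times. [folklore] -/
theorem Wt_pos (h : C.validB = true) (t : ℝ) : 0 < C.Wt t :=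
  Aff.eval_pos (W_ltB h) (clock_mem_Icc _ _ _)

/-- After the squeeze window the slope is the final slope. [folklore] -/
theorem Wt_of_ge (h : C.validB = true) {t : ℝ} (ht : (C.t₀ : ℝ) + 2 * C.τ / 3 ≤ t) : C.Wt t = C.W.v1 := by
  rw [Wt, clock_of_ge (τ_pos h) ht, Aff.eval_one]

/-- After the squeeze window the rate vanishes. [folklore] -/
theorem rt_of_gt (h : C.validB = true) {t : ℝ} (ht : (C.t₀ : ℝ) + 2 * C.τ / 3 < t) : C.rt t = 0 := by
  rw [rt, clockDeriv_of_gt (τ_pos h) ht, zero_mul, zero_div]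

/-! ### The transversal plateau -/

/-- The transversal plateau is even. [folklore] -/
theorem pT_neg (x : ℝ) : C.pT (-x) = C.pT x := by
  simp only [pT, plateau_apply]
  rw [mul_comm]
  congr 1 <;> congr 1 <;> ring

/-- The derivative of the transversal plateau is odd. [folklore] -/
theorem deriv_pT_neg (x : ℝ) : deriv C.pT (-x) = -deriv C.pT x := by
  have h : (fun y => C.pT (-y)) = C.pT := funext fun y => pT_neg y
  have := deriv_comp_neg C.pT x
  rw [h] at this
  linarith

/-- The transversal plateau is smooth. [folklore] -/
theorem pT_contDiff {n : ℕ∞} : ContDiff ℝ n C.pT := plateau_contDiff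

/-- The transversal plateau vanishes at offset `≥ δ` (valid datum), on a neighbourhood. [folklore] -/
theorem pT_eventually_zero (h : C.validB = true) {x : ℝ} (hx : (C.δ : ℝ) ≤ |x|) : ∀ᶠ y in 𝓝 x, C.pT y = 0 := by
  have hρ := ρ_pos h
  have hth := th_lt h
  rcases le_abs'.1 hx with hx | hx
  · have : ∀ᶠ y in 𝓝 x, y < -(C.th : ℝ) + C.ρ / 3 := eventually_lt_nhds (by linarith)
    exact this.mono fun y hy => plateau_of_le_left hρ hy.le
  · have : ∀ᶠ y in 𝓝 x, (C.th : ℝ) - C.ρ / 3 < y := eventually_gt_nhds (by linarith)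
    exact this.mono fun y hy => plateau_of_ge_right hρ hy.le

/-- The transversal plateau vanishes at offset `≥ δ`. [folklore] -/
theorem pT_zero (h : C.validB = true) {x : ℝ} (hx : (C.δ : ℝ) ≤ |x|) : C.pT x = 0 :=
  (pT_eventually_zero h hx).self_of_nhds

/-- The derivative of the transversal plateau vanishes at offset `≥ δ`. [folklore] -/
theorem deriv_pT_zero (h : C.validB = true) {x : ℝ} (hx : (C.δ : ℝ) ≤ |x|) : deriv C.pT x = 0 := by
  rw [Filter.EventuallyEq.deriv_eq (pT_eventually_zero h hx)]; exact deriv_const x 0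

/-! ### Closed forms, the velocity as a perpendicular gradient -/

/-- Unfolding the axis-`0` stream function. [folklore] -/
@[simp] theorem HgT_zero (t : ℝ) (ζ : E²) : C.HgT 0 t ζ = -C.rt t * ζ 0 * ζ 1 * C.pT (ζ 1) := by simp [HgT]

/-- Unfolding the axis-`1` stream function. [folklore] -/
@[simp] theorem HgT_one (t : ℝ) (ζ : E²) : C.HgT 1 t ζ = C.rt t * ζ 0 * ζ 1 * C.pT (ζ 0) := by simp [HgT]

/-- Unfolding the axis-`0` velocity. [folklore] -/
@[simp] theorem VgT_zero (t : ℝ) (ζ : E²) :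
    C.VgT 0 t ζ = vec2 (-C.rt t * ζ 0 * (C.pT (ζ 1) + ζ 1 * deriv C.pT (ζ 1))) (C.rt t * ζ 1 * C.pT (ζ 1)) := by
  simp [VgT]

/-- Unfolding the axis-`1` velocity. [folklore] -/
@[simp] theorem VgT_one (t : ℝ) (ζ : E²) :
    C.VgT 1 t ζ = vec2 (C.rt t * ζ 0 * C.pT (ζ 0)) (-C.rt t * ζ 1 * (C.pT (ζ 0) + ζ 0 * deriv C.pT (ζ 0))) := by
  simp [VgT]

/-- Unfolding the axis-`0` scalar. [folklore] -/
@[simp] theorem ΘgT_zero (G : ℝ → ℝ) (t : ℝ) (ζ : E²) : C.ΘgT G 0 t ζ = C.pT (ζ 1) * G (ζ 1 / C.Wt t) := by simp [ΘgT]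

/-- Unfolding the axis-`1` scalar. [folklore] -/
@[simp] theorem ΘgT_one (G : ℝ → ℝ) (t : ℝ) (ζ : E²) : C.ΘgT G 1 t ζ = C.pT (ζ 0) * G (ζ 0 / C.Wt t) := by simp [ΘgT]

/-- The derivative of the plateau. [folklore] -/
theorem hasDerivAt_pT (x : ℝ) : HasDerivAt C.pT (deriv C.pT x) x :=
  ((pT_contDiff (C := C) (n := 1)).differentiable (by simp) x).hasDerivAt

/-- **The axis-`0` template velocity is the perpendicular gradient of its stream function.** [folklore] -/
theorem VgT_zero_eq_perpGrad (t : ℝ) (ζ : E²) : C.VgT 0 t ζ = perpGrad (C.HgT 0 t) ζ := by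
  have e : C.HgT 0 t = fun w : E² => (fun a b : ℝ => -C.rt t * a * b * C.pT b) (w 0) (w 1) := by
    funext w; simp
  rw [VgT_zero, e]
  have hd : DifferentiableAt ℝ (uncurry fun a b : ℝ => -C.rt t * a * b * C.pT b) (ζ 0, ζ 1) := by
    have : (uncurry fun a b : ℝ => -C.rt t * a * b * C.pT b) = fun p : ℝ × ℝ => -C.rt t * p.1 * p.2 * C.pT p.2 := by
      funext p; rfl
    rw [this]
    exact (((differentiableAt_const _).mul differentiableAt_fst).mul differentiableAt_snd).mul
      ((pT_contDiff (C := C) (n := 1)).differentiable (by simp) _ |>.comp _ differentiableAt_snd)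
  have hx : HasDerivAt (fun a => -C.rt t * a * ζ 1 * C.pT (ζ 1)) (-C.rt t * ζ 1 * C.pT (ζ 1)) (ζ 0) :=
    ((((hasDerivAt_id (ζ 0)).const_mul (-C.rt t)).mul_const (ζ 1)).mul_const (C.pT (ζ 1))).congr_deriv (by ring)
  have hy : HasDerivAt (fun b => -C.rt t * ζ 0 * b * C.pT b)
      (-C.rt t * ζ 0 * (C.pT (ζ 1) + ζ 1 * deriv C.pT (ζ 1))) (ζ 1) :=
    (((hasDerivAt_id (ζ 1)).const_mul (-C.rt t * ζ 0)).mul (hasDerivAt_pT (C := C) (ζ 1))).congr_deriv (by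
      simp only [id]; ring)
  apply vec2_eq_perpGrad
  · rw [fderiv_coordFun_apply hd hx hy]; simp
  · rw [fderiv_coordFun_apply hd hx hy]; simp

/-- **The axis-`1` template velocity is the perpendicular gradient of its stream function.** [folklore] -/
theorem VgT_one_eq_perpGrad (t : ℝ) (ζ : E²) : C.VgT 1 t ζ = perpGrad (C.HgT 1 t) ζ := by
  have e : C.HgT 1 t = fun w : E² => (fun a b : ℝ => C.rt t * a * b * C.pT a) (w 0) (w 1) := by
    funext w; simp
  rw [VgT_one, e]
  have hd : DifferentiableAt ℝ (uncurry fun a b : ℝ => C.rt t * a * b * C.pT a) (ζ 0, ζ 1) := by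
    have : (uncurry fun a b : ℝ => C.rt t * a * b * C.pT a) = fun p : ℝ × ℝ => C.rt t * p.1 * p.2 * C.pT p.1 := by
      funext p; rfl
    rw [this]
    exact (((differentiableAt_const _).mul differentiableAt_fst).mul differentiableAt_snd).mul
      ((pT_contDiff (C := C) (n := 1)).differentiable (by simp) _ |>.comp _ differentiableAt_fst)
  have hx : HasDerivAt (fun a => C.rt t * a * ζ 1 * C.pT a)
      (C.rt t * ζ 1 * (C.pT (ζ 0) + ζ 0 * deriv C.pT (ζ 0))) (ζ 0) :=
    ((((hasDerivAt_id (ζ 0)).const_mul (C.rt t)).mul_const (ζ 1)).mul (hasDerivAt_pT (C := C) (ζ 0))).congr_deriv (by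
      simp only [id]; ring)
  have hy : HasDerivAt (fun b => C.rt t * ζ 0 * b * C.pT (ζ 0)) (C.rt t * ζ 0 * C.pT (ζ 0)) (ζ 1) :=
    ((((hasDerivAt_id (ζ 1)).const_mul (C.rt t * ζ 0))).mul_const (C.pT (ζ 0))).congr_deriv (by ring)
  apply vec2_eq_perpGrad
  · rw [fderiv_coordFun_apply hd hx hy]; simp
  · rw [fderiv_coordFun_apply hd hx hy]; simp

/-- **The template velocity is the perpendicular gradient of the template stream function.** [folklore] -/
theorem VgT_eq_perpGrad (k : Fin 2) (t : ℝ) (ζ : E²) : C.VgT k t ζ = perpGrad (C.HgT k t) ζ := by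
  fin_cases k
  · exact VgT_zero_eq_perpGrad t ζ
  · exact VgT_one_eq_perpGrad t ζ

/-! ### Tangency, vanishing, equivariance -/

/-- **The template velocity is tangent to its face.** [folklore] -/
theorem VgT_tangent (k : Fin 2) (t : ℝ) {ζ : E²} (hζ : ζ k = 0) : C.VgT k t ζ k = 0 := by
  fin_cases k
  · simp only [Fin.zero_eta, Fin.isValue] at hζ ⊢
    simp [hζ, vec2_apply_zero]
  · simp only [Fin.mk_one, Fin.isValue] at hζ ⊢
    simp [hζ, vec2_apply_one]

/-- **The template fields vanish at transversal offset `≥ δ`.** [folklore] -/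
theorem template_vanish (h : C.validB = true) (G : ℝ → ℝ) (k : Fin 2) (t : ℝ) {ζ : E²}
    (hζ : ∃ j, j ≠ k ∧ (C.δ : ℝ) ≤ |ζ j|) : C.VgT k t ζ = 0 ∧ C.ΘgT G k t ζ = 0 := by
  obtain ⟨j, hjk, hj⟩ := hζ
  fin_cases k
  · have hj1 : j = 1 := by fin_cases j <;> simp_all
    subst hj1
    simp [pT_zero h hj, deriv_pT_zero h hj, vec2_eq_zero_iff]
  · have hj0 : j = 0 := by fin_cases j <;> simp_all
    subst hj0
    simp [pT_zero h hj, deriv_pT_zero h hj, vec2_eq_zero_iff]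

/-- **The template is an equivariant gate field** for an even profile. [folklore] -/
theorem isEquivariantGateField_template {G : ℝ → ℝ} (hGe : ∀ x, G (-x) = G x) :
    IsEquivariantGateField C.VgT (C.ΘgT G) := by
  refine IsEquivariantGateField.of_parity ?_ ?_ ?_ ?_ ?_ ?_
  · intro t ζ
    simp only [VgT_zero, vec2_eq_euclidean_lit]
    congr 1; funext i; fin_cases i <;> simp
  · intro t ζ
    simp only [VgT_zero, vec2_eq_euclidean_lit]
    congr 1; funext i; fin_cases i <;> simp [pT_neg, deriv_pT_neg]
  · intro t ζ
    simp only [VgT_zero, VgT_one, vec2_eq_euclidean_lit]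
    congr 1
  · intro t ζ
    simp
  · intro t ζ
    simp [pT_neg, hGe, neg_div]
  · intro t ζ
    simp

/-! ### The stream function without cut-off and the time condition -/

/-- The template stream function before the transversal cut-off. [folklore] -/
def ΨT (k : Fin 2) (t : ℝ) (ζ : E²) : ℝ := if k = 0 then -C.rt t * ζ 0 * ζ 1 else C.rt t * ζ 0 * ζ 1

/-- The other axis. [folklore] -/
def oth (k : Fin 2) : Fin 2 := if k = 0 then 1 else 0

/-- The other axis of `0` is `1`. [folklore] -/
@[simp] theorem oth_zero : oth 0 = 1 := rfl

/-- The other axis of `1` is `0`. [folklore] -/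
@[simp] theorem oth_one : oth 1 = 0 := rfl

/-- The other axis is different. [folklore] -/
theorem oth_ne (k : Fin 2) : oth k ≠ k := by fin_cases k <;> simp

/-- An axis different from `k` is the other axis. [folklore] -/
theorem eq_oth_of_ne {j k : Fin 2} (h : j ≠ k) : j = oth k := by
  fin_cases j <;> fin_cases k <;> simp_all

/-- The template stream function is the cut-off of `ΨT`. [folklore] -/
theorem HgT_eq (k : Fin 2) (t : ℝ) (ζ : E²) : C.HgT k t ζ = C.pT (ζ (oth k)) * C.ΨT k t ζ := by
  fin_cases k <;> simp [ΨT] <;> ring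

/-- The template scalar through the other axis. [folklore] -/
theorem ΘgT_eq (G : ℝ → ℝ) (k : Fin 2) (t : ℝ) (ζ : E²) :
    C.ΘgT G k t ζ = C.pT (ζ (oth k)) * G (ζ (oth k) / C.Wt t) := by
  fin_cases k <;> simp

/-- After the squeeze window `ΨT` vanishes. [folklore] -/
theorem ΨT_of_gt (h : C.validB = true) (k : Fin 2) {t : ℝ} (ht : (C.t₀ : ℝ) + 2 * C.τ / 3 < t) (ζ : E²) :
    C.ΨT k t ζ = 0 := by
  simp [ΨT, rt_of_gt h ht]

/-- **Time condition** of a stub: either the phase runs on the squeeze clock (`sq`), or the time is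
past the squeeze window. [folklore] -/
def TimeOK (sq : Bool) (t : ℝ) : Prop := sq = true ∨ (C.t₀ : ℝ) + 2 * C.τ / 3 < t

/-- The time condition is open. [folklore] -/
theorem isOpen_timeOK (sq : Bool) : IsOpen {t : ℝ | C.TimeOK sq t} := by
  cases sq
  · simp only [TimeOK, Bool.false_eq_true, false_or]; exact isOpen_Ioi
  · simp [TimeOK]

/-! ### Gate frames -/

/-- **The inward frame code of a face**: the run frame whose abscissa points into the square
(`E` at the left face, `W` at the right face, `N` at the lower face, `S` at the upper face). [folklore] -/
def oIn (k : Fin 2) (s : Bool) : Fin 8 := if k = 0 then (if s then 2 else 0) else (if s then 6 else 7)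

/-- The frame abscissa of a face: `0` for the faces through the origin, `-1` for the others. [folklore] -/
def uF (s : Bool) : ℚ := if s then -1 else 0

/-- The rational face value. [folklore] -/
def fQ (s : Bool) : ℚ := if s then 1 else 0

/-- The sign of the inward normal. [folklore] -/
def sgnF (s : Bool) : ℝ := if s then -1 else 1

/-- The orientation sign of the axis. [folklore] -/
def sgnK (k : Fin 2) : ℝ := if k = 0 then 1 else -1

/-- The rational face value is the face value. [folklore] -/
@[simp] theorem cast_fQ (s : Bool) : ((fQ s : ℚ) : ℝ) = faceValue s := by cases s <;> simp [fQ]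

/-- **The gate frame**: abscissa `uF + sgnF · (z_k - faceValue)`, ordinate `z_{k'}`, determinant
`sgnF · sgnK`. [folklore] -/
theorem frame_gate (k : Fin 2) (s : Bool) (z : E²) :
    ((d4Frame (oIn k s)).app z) 0 = (uF s : ℝ) + sgnF s * (z k - faceValue s) ∧
      ((d4Frame (oIn k s)).app z) 1 = z (oth k) ∧ (d4Frame (oIn k s)).det = sgnF s * sgnK k := by
  fin_cases k <;> cases s <;>
    simp [oIn, uF, sgnF, sgnK, d4Frame, d4a, d4b, d4c, d4d, LinFrame.app_apply, LinFrame.det,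
      vec2_apply_zero, vec2_apply_one] <;> ring

/-- `ΨT` in the gate frame. [folklore] -/
theorem ΨT_gate (k : Fin 2) (s : Bool) (t : ℝ) (z : E²) :
    C.ΨT k t (z - faceMidpoint k s) =
      -(sgnF s * sgnK k)⁻¹ * (C.rt t * (sgnF s * (z k - faceValue s)) * (z (oth k) - 1 / 2)) := by
  fin_cases k <;> cases s <;> simp [ΨT, sgnF, sgnK, faceMidpoint_apply] <;> ring

end GateC

/-! ## Checks on boxes, steps and stub elements -/

namespace BoxQ

/-- Lower edge of axis `k`. [folklore] -/
def lo (B : BoxQ) (k : Fin 2) : Aff := if k = 0 then B.a₀ else B.a₁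

/-- Upper edge of axis `k`. [folklore] -/
def hi (B : BoxQ) (k : Fin 2) : Aff := if k = 0 then B.b₀ else B.b₁

/-- Bounds of the support box along axis `k`. [folklore] -/
theorem supp_bounds {B : BoxQ} {α : ℝ} {z : E²} (hz : z ∈ (B.frzAt α).supp) (k : Fin 2) :
    (B.lo k).eval α + B.ρ / 3 ≤ z k ∧ z k ≤ (B.hi k).eval α - B.ρ / 3 := by
  obtain ⟨h1, h2, h3, h4⟩ := hz
  simp only [BoxQ.frzAt] at h1 h2 h3 h4
  fin_cases k
  · exact ⟨by simpa [lo] using h1, by simpa [hi] using h2⟩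
  · exact ⟨by simpa [lo] using h3, by simpa [hi] using h4⟩

/-- **Strip avoidance test**: the support box stays on one side of the face strip
`{|z_k - faceValue s| < δ}` at both clock endpoints. [folklore] -/
def avoidStripB (B : BoxQ) (k : Fin 2) (s : Bool) (δ : ℚ) : Bool :=
  Aff.leB (Aff.const (GateC.fQ s + δ)) ((B.lo k).add (Aff.const (B.ρ / 3))) ||
    Aff.leB ((B.hi k).sub (Aff.const (B.ρ / 3))) (Aff.const (GateC.fQ s - δ))

/-- **Soundness of strip avoidance**: a point of the support box is not in the face strip. [folklore] -/
theorem not_strip_of_avoidStripB {B : BoxQ} {k : Fin 2} {s : Bool} {δ : ℚ} (h : B.avoidStripB k s δ = true)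
    {α : ℝ} (hα : α ∈ Icc (0 : ℝ) 1) {z : E²} (hz : z ∈ (B.frzAt α).supp) : ¬ |z k - faceValue s| < δ := by
  intro hlt
  rw [abs_lt] at hlt
  have hb := supp_bounds hz k
  simp only [avoidStripB, Bool.or_eq_true] at h
  rcases h with h | h
  · have e := Aff.eval_le_eval h hα
    simp only [Aff.eval_const, Aff.eval_add, Rat.cast_add, GateC.cast_fQ] at e
    push_cast at e
    linarith [hb.1]
  · have e := Aff.eval_le_eval h hα
    simp only [Aff.eval_const, Aff.eval_sub, Rat.cast_sub, GateC.cast_fQ] at e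
    push_cast at e
    linarith [hb.2]

/-- **Stub box test** at the gate `(k, s)`: transition length `ρ` of the template, the normal
plateau equal to `1` on the window `[faceValue s - δ, faceValue s + δ]` at both clock endpoints, and
the transversal edges exactly `1/2 ∓ th`. [folklore] -/
def stubBoxB (B : BoxQ) (C : GateC) (k : Fin 2) (s : Bool) : Bool :=
  decide (B.ρ = C.ρ) &&
    Aff.leB ((B.lo k).add (Aff.const (2 * C.ρ / 3))) (Aff.const (GateC.fQ s - C.δ)) &&
    Aff.leB (Aff.const (GateC.fQ s + C.δ)) ((B.hi k).sub (Aff.const (2 * C.ρ / 3))) &&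
    decide (B.lo (GateC.oth k) = Aff.const (1 / 2 - C.th)) && decide (B.hi (GateC.oth k) = Aff.const (1 / 2 + C.th))

/-- **The plateau of a stub box on the face strip** is the transversal template plateau. [folklore] -/
theorem val_of_stubBoxB {B : BoxQ} {C : GateC} {k : Fin 2} {s : Bool} (h : B.stubBoxB C k s = true)
    (hC : C.validB = true) {α : ℝ} (hα : α ∈ Icc (0 : ℝ) 1) {z : E²} (hz : |z k - faceValue s| < C.δ) :
    (B.frzAt α).val z = C.pT (z (GateC.oth k) - 1 / 2) := by
  simp only [stubBoxB, Bool.and_eq_true, decide_eq_true_eq] at h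
  obtain ⟨⟨⟨⟨hρ, h1⟩, h2⟩, h3⟩, h4⟩ := h
  have e1 := Aff.eval_le_eval h1 hα
  have e2 := Aff.eval_le_eval h2 hα
  simp only [Aff.eval_const, Aff.eval_add, Aff.eval_sub, Rat.cast_add, Rat.cast_sub, GateC.cast_fQ] at e1 e2
  push_cast at e1 e2
  rw [abs_lt] at hz
  have hρ' := GateC.ρ_pos hC
  rw [BoxPlateau.val_apply]
  simp only [BoxQ.frzAt]
  have hk : k = 0 ∨ k = 1 := by fin_cases k <;> simp
  rcases hk with rfl | rfl
  · simp only [lo, hi, GateC.oth_zero, Fin.isValue, ↓reduceIte, one_ne_zero] at h3 h4 e1 e2 hz ⊢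
    rw [hρ, h3, h4, plateau_of_mem hρ' (by linarith) (by linarith), one_mul, GateC.pT, plateau_apply, plateau_apply]
    simp only [Aff.eval_const]
    push_cast
    congr 1 <;> congr 1 <;> ring
  · simp only [lo, hi, GateC.oth_one, Fin.isValue, ↓reduceIte, one_ne_zero] at h3 h4 e1 e2 hz ⊢
    rw [hρ, h3, h4, plateau_of_mem (x := z 1) hρ' (by linarith) (by linarith), mul_one, GateC.pT, plateau_apply,
      plateau_apply]
    simp only [Aff.eval_const]
    push_cast
    congr 1 <;> congr 1 <;> ring

/-- **A stub box on the face strip is transversally inside the `δ`-window.** [folklore] -/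
theorem transversal_of_stubBoxB {B : BoxQ} {C : GateC} {k : Fin 2} {s : Bool} (h : B.stubBoxB C k s = true)
    (hC : C.validB = true) {α : ℝ} {z : E²} (hz : z ∈ (B.frzAt α).supp) : |z (GateC.oth k) - 1 / 2| < C.δ := by
  simp only [stubBoxB, Bool.and_eq_true, decide_eq_true_eq] at h
  obtain ⟨⟨⟨⟨hρ, -⟩, -⟩, h3⟩, h4⟩ := h
  have hb := supp_bounds hz (GateC.oth k)
  rw [h3, h4, hρ] at hb
  simp only [Aff.eval_const] at hb
  push_cast at hb
  have := GateC.th_lt hC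
  rw [abs_lt]
  constructor <;> linarith [hb.1, hb.2]

end BoxQ

namespace StepQ

/-- Bounds of coordinate `i` over the closed gate window of the face `(k, s)`. [folklore] -/
def winLo (C : GateC) (k : Fin 2) (s : Bool) (i : Fin 2) : ℚ := if i = k then GateC.fQ s - C.δ else 1 / 2 - 2 * C.δ

/-- Bounds of coordinate `i` over the closed gate window of the face `(k, s)`. [folklore] -/
def winHi (C : GateC) (k : Fin 2) (s : Bool) (i : Fin 2) : ℚ := if i = k then GateC.fQ s + C.δ else 1 / 2 + 2 * C.δ

/-- A coordinate of a window point is within the window bounds. [folklore] -/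
theorem mem_win {C : GateC} {k : Fin 2} {s : Bool} {z : E²} (hz : |z k - faceValue s| < C.δ)
    (hw : |z (GateC.oth k) - 1 / 2| < 2 * C.δ) (i : Fin 2) :
    (winLo C k s i : ℝ) ≤ z i ∧ z i ≤ (winHi C k s i : ℝ) := by
  rw [abs_lt] at hz hw
  by_cases hi : i = k
  · subst hi
    simp only [winLo, winHi, ↓reduceIte, Rat.cast_sub, Rat.cast_add, GateC.cast_fQ]
    constructor <;> linarith
  · simp only [winLo, winHi, if_neg hi]
    rw [GateC.eq_oth_of_ne hi]
    push_cast
    constructor <;> linarith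

/-- **Out-step test**: the step argument is at most `1/3` on the window of `(k, s)` at both clock
endpoints. [folklore] -/
def outStepB (J : StepQ) (C : GateC) (k : Fin 2) (s : Bool) : Bool :=
  decide (0 < J.len) &&
    Aff.leB ((Aff.const (max (J.sgn * winLo C k s J.axis) (J.sgn * winHi C k s J.axis))).sub (Aff.smul J.sgn J.pos))
      (Aff.const (J.len / 3))

/-- **In-step test**: the step argument is at least `2/3` on the window of `(k, s)` at both clock
endpoints. [folklore] -/
def inStepB (J : StepQ) (C : GateC) (k : Fin 2) (s : Bool) : Bool :=
  decide (0 < J.len) &&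
    Aff.leB (Aff.const (2 * J.len / 3))
      ((Aff.const (min (J.sgn * winLo C k s J.axis) (J.sgn * winHi C k s J.axis))).sub (Aff.smul J.sgn J.pos))

/-- A linear function of a coordinate in an interval is at most its larger endpoint value. [folklore] -/
theorem mul_le_max {c lo hi x : ℝ} (h1 : lo ≤ x) (h2 : x ≤ hi) : c * x ≤ max (c * lo) (c * hi) := by
  rcases le_total 0 c with hc | hc
  · exact le_max_of_le_right (mul_le_mul_of_nonneg_left h2 hc)
  · exact le_max_of_le_left (mul_le_mul_of_nonpos_left h1 hc)

/-- A linear function of a coordinate in an interval is at least its smaller endpoint value. [folklore] -/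
theorem min_le_mul {c lo hi x : ℝ} (h1 : lo ≤ x) (h2 : x ≤ hi) : min (c * lo) (c * hi) ≤ c * x := by
  rcases le_total 0 c with hc | hc
  · exact min_le_of_left_le (mul_le_mul_of_nonneg_left h1 hc)
  · exact min_le_of_right_le (mul_le_mul_of_nonpos_left h2 hc)

/-- **Soundness of the out-step test.** [folklore] -/
theorem arg_le_of_outStepB {J : StepQ} {C : GateC} {k : Fin 2} {s : Bool} (h : J.outStepB C k s = true)
    (t₀ τ t : ℝ) {z : E²} (hz : |z k - faceValue s| < C.δ) (hw : |z (GateC.oth k) - 1 / 2| < 2 * C.δ) :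
    (J.toJ t₀ τ).arg t z ≤ 1 / 3 := by
  simp only [outStepB, Bool.and_eq_true, decide_eq_true_eq] at h
  obtain ⟨hlen, hle⟩ := h
  have e := Aff.eval_le_eval hle (clock_mem_Icc t₀ τ t)
  simp only [Aff.eval_sub, Aff.eval_const, Aff.eval_smul, Rat.cast_max, Rat.cast_mul] at e
  have hb := mem_win hz hw J.axis
  have hm := mul_le_max (c := (J.sgn : ℝ)) hb.1 hb.2
  have hlen' : (0 : ℝ) < J.len := by exact_mod_cast hlen
  rw [StepQ.toJ_arg, div_le_iff₀ hlen']
  push_cast at e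
  nlinarith

/-- **Soundness of the in-step test.** [folklore] -/
theorem le_arg_of_inStepB {J : StepQ} {C : GateC} {k : Fin 2} {s : Bool} (h : J.inStepB C k s = true)
    (t₀ τ t : ℝ) {z : E²} (hz : |z k - faceValue s| < C.δ) (hw : |z (GateC.oth k) - 1 / 2| < 2 * C.δ) :
    2 / 3 ≤ (J.toJ t₀ τ).arg t z := by
  simp only [inStepB, Bool.and_eq_true, decide_eq_true_eq] at h
  obtain ⟨hlen, hle⟩ := h
  have e := Aff.eval_le_eval hle (clock_mem_Icc t₀ τ t)
  simp only [Aff.eval_sub, Aff.eval_const, Aff.eval_smul, Rat.cast_min, Rat.cast_mul] at e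
  have hb := mem_win hz hw J.axis
  have hm := min_le_mul (c := (J.sgn : ℝ)) hb.1 hb.2
  have hlen' : (0 : ℝ) < J.len := by exact_mod_cast hlen
  rw [StepQ.toJ_arg, le_div_iff₀ hlen']
  push_cast at e
  nlinarith

end StepQ

namespace RunQ

variable (r : RunQ)

/-- **Frame test of a stub run** at the gate `(k, s)`: inward frame, transverse line `1/2`, no
stream offset, and the tangency relation `c' + uF · s' = 0` of the material map (no flux through
the face). [folklore] -/
def frameOKB (k : Fin 2) (s : Bool) : Bool :=
  decide (r.o = GateC.oIn k s) && decide (r.y = Aff.const (1 / 2)) && decide (r.cR = Aff.const 0) &&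
    decide (r.cK = Aff.const 0) && decide (r.Ξ.c.v1 - r.Ξ.c.v0 + GateC.uF s * (r.Ξ.s.v1 - r.Ξ.s.v0) = 0)

/-- **Gap test of a stub run**: every kink of the material map begins beyond the window. [folklore] -/
def gapOKB (s : Bool) (δ : ℚ) : Bool :=
  r.Ξ.kinks.all fun kk => Aff.leB (Aff.const (GateC.uF s + δ)) (kk.b.add (Aff.const (kk.ℓ / 3)))

/-- **Squeeze case** of the schedule test: the phase clock is the squeeze clock and the base slope
of the stub is the template schedule. [folklore] -/
def sqB (C : GateC) (t₀ τ : ℚ) : Bool := decide (t₀ = C.t₀) && decide (τ = C.τ) && decide (r.Ξ.s = C.W)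

/-- **Schedule test**: squeeze case, or static case (constant final slope, slot after the squeeze
window). [folklore] -/
def schedB (C : GateC) (t₀ τ a : ℚ) : Bool :=
  r.sqB C t₀ τ || (decide (r.Ξ.s = Aff.const C.W.v1) && decide (C.t₀ + C.τ ≤ a))

variable {r}

/-- The time condition from the schedule test and the slot. [folklore] -/
theorem timeOK_of_schedB {C : GateC} {t₀ τ a : ℚ} (h : r.schedB C t₀ τ a = true) (hC : C.validB = true)
    {t : ℝ} (ht : (a : ℝ) ≤ t) : C.TimeOK (r.sqB C t₀ τ) t := by
  simp only [schedB, Bool.or_eq_true] at h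
  rcases h with h | h
  · exact Or.inl h
  · simp only [Bool.and_eq_true, decide_eq_true_eq] at h
    right
    have hτ := GateC.τ_pos hC
    have : (C.t₀ : ℝ) + C.τ ≤ a := by exact_mod_cast h.2
    linarith

/-- The frame abscissa of a window point is below every kink. [folklore] -/
theorem inGap_of_gapOKB {s : Bool} {δ : ℚ} (h : r.gapOKB s δ = true) {α : ℝ} (hα : α ∈ Icc (0 : ℝ) 1) {u : ℝ}
    (hu : u ≤ GateC.uF s + δ) : r.Ξ.InGap 0 α u := by
  refine ⟨fun kk hk => by simp at hk, fun kk hk => ?_⟩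
  rw [List.drop_zero] at hk
  have := List.all_eq_true.1 h kk hk
  have e := Aff.eval_le_eval this hα
  simp only [Aff.eval_const, Aff.eval_add, Rat.cast_add] at e
  push_cast at e
  linarith

/-- **The fields of a stub run on the face strip**: the scalar is the template scalar (without
cut-off) and the stream function is `ΨT`, placed at the gate. [folklore] -/
theorem stub_fields {C : GateC} {k : Fin 2} {s : Bool} {t₀ τ a : ℚ} (hv : r.validB = true)
    (hf : r.frameOKB k s = true) (hg : r.gapOKB s C.δ = true) (hs : r.schedB C t₀ τ a = true) (hC : C.validB = true)
    (G : ℝ → ℝ) {t : ℝ} (ht : C.TimeOK (r.sqB C t₀ τ) t) {z : E²} (hz : |z k - faceValue s| < C.δ) :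
    r.scalar t₀ τ G t z = G ((z (GateC.oth k) - 1 / 2) / C.Wt t) ∧
      r.stream t₀ τ t z = C.ΨT k t (z - faceMidpoint k s) := by
  simp only [frameOKB, Bool.and_eq_true, decide_eq_true_eq] at hf
  obtain ⟨⟨⟨⟨ho, hy⟩, hcR⟩, hcK⟩, htan⟩ := hf
  have hF : r.Ξ.LenPos := Pw.lenPos_of_matValidB hv
  obtain ⟨hu0, hv1, hdet⟩ := GateC.frame_gate k s z
  rw [← ho] at hu0 hv1 hdet
  set u : ℝ := ((d4Frame r.o).app z) 0 with hu
  -- the window abscissa is below the kinks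
  have hzk := (abs_lt.1 hz)
  have hule : u ≤ GateC.uF s + C.δ := by
    rw [hu0]; cases s <;> simp [GateC.uF, GateC.sgnF] at hzk ⊢ <;> linarith [hzk.1, hzk.2]
  have hgap : ∀ t', r.Ξ.InGap 0 (clock t₀ τ t') u := fun t' => inGap_of_gapOKB hg (clock_mem_Icc _ _ _) hule
  have hdu : ∀ t', r.Ξ.du (clock t₀ τ t') u = r.Ξ.s.eval (clock t₀ τ t') := fun t' => by
    rw [r.Ξ.du_eq_W hF (hgap t'), Pw.W]; simp
  have hdα : ∀ t', r.Ξ.dα (clock t₀ τ t') u = r.Ξ.s.rate * (u - GateC.uF s) := fun t' => by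
    rw [r.Ξ.dα_eq_gapDα hF (hgap t'), Pw.gapDα]
    simp only [List.take_zero, List.map_nil, List.sum_nil, add_zero]
    have htan' : (r.Ξ.c.v1 : ℝ) - r.Ξ.c.v0 + GateC.uF s * (r.Ξ.s.v1 - r.Ξ.s.v0) = 0 := by exact_mod_cast htan
    rw [Aff.rate_apply, Aff.rate_apply]
    linarith [htan']
  -- the slope and the rate in the two cases of the schedule
  have hsched : r.Ξ.s.eval (clock t₀ τ t) = C.Wt t ∧
      clockDeriv t₀ τ t * r.Ξ.s.rate / r.Ξ.s.eval (clock t₀ τ t) = C.rt t := by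
    simp only [schedB, Bool.or_eq_true] at hs
    rcases ht with hsq | hgt
    · simp only [sqB, Bool.and_eq_true, decide_eq_true_eq] at hsq
      obtain ⟨⟨h1, h2⟩, h3⟩ := hsq
      subst h1; subst h2; rw [h3]; exact ⟨rfl, rfl⟩
    · rcases hs with hsq | hst
      · simp only [sqB, Bool.and_eq_true, decide_eq_true_eq] at hsq
        obtain ⟨⟨h1, h2⟩, h3⟩ := hsq
        subst h1; subst h2; rw [h3]; exact ⟨rfl, rfl⟩
      · simp only [Bool.and_eq_true, decide_eq_true_eq] at hst
        rw [hst.1, GateC.Wt_of_ge hC hgt.le, GateC.rt_of_gt hC hgt]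
        simp
  constructor
  · -- scalar
    rw [RunQ.scalar, LinFrame.conjScalar_apply, runScalar_apply, ← hu, hv1]
    simp only [RunQ.yF, Pw.cdu, hy, Aff.eval_const, hdu, hsched.1]
    push_cast; ring_nf
  · -- stream
    rw [RunQ.stream]
    simp only [LinFrame.conjStream_apply, runStream_apply, streamOffset, hcR, hcK, Aff.eval_const,
      Rat.cast_zero, zero_mul, add_zero, mul_zero, RunQ.y'F, RunQ.yF, hy, Aff.rate_const, ← hu, hv1, hdet, axialRate,
      Pw.cdu, Pw.cdt, hdu, hdα, GateC.ΨT_gate]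
    rw [← hsched.2, hu0]
    push_cast
    have hW : r.Ξ.s.eval (clock (t₀ : ℝ) τ t) ≠ 0 := by rw [hsched.1]; exact (GateC.Wt_pos hC t).ne'
    have hsg : GateC.sgnF s * GateC.sgnK k ≠ 0 := by cases s <;> fin_cases k <;> simp [GateC.sgnF, GateC.sgnK]
    field_simp
    ring

end RunQ

/-! ## Gate checks of a phase and their soundness -/

namespace PhaseQ

variable (P : PhaseQ)

/-- **Stub element test** of node `n` at the gate `(k, s)`. [folklore] -/
def stubNodeB (C : GateC) (a : ℚ) (n : ℕ) (k : Fin 2) (s : Bool) : Bool :=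
  match (P.node n).e with
  | .dg _ => false
  | .run r => r.frameOKB k s && r.gapOKB s C.δ && r.schedB C P.t₀ P.τ a

/-- **Face test** of the face `(k, s)`: without a stub, every support box avoids the face strip;
with the stub node `n`, every other support box avoids the face strip, the box of `n` is a stub
box, its element a stub run on the template schedule, and the neighbouring junction steps are
saturated on the gate window. [folklore] -/
def gateFaceB (C : GateC) (stub : Fin 2 → Bool → Option ℕ) (a : ℚ) (k : Fin 2) (s : Bool) : Bool :=
  match stub k s with
  | none => (List.range P.K).all fun j => (P.node j).box.avoidStripB k s C.δ
  | some n => decide (n < P.K) &&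
      ((List.range P.K).all fun j => decide (j = n) || (P.node j).box.avoidStripB k s C.δ) &&
      (P.node n).box.stubBoxB C k s && P.stubNodeB C a n k s &&
      (!decide (n + 1 < P.K) || (P.node n).step.outStepB C k s) &&
      (decide (n = 0) || (P.node (n - 1)).step.inStepB C k s)

/-- **Gate test of a phase** on the slot starting at `a`, for the template datum `C` and the stub
table `stub` (the node index of the stub at each gate face, `none` at the other faces). [folklore] -/
def gateOKB (C : GateC) (stub : Fin 2 → Bool → Option ℕ) (a : ℚ) : Bool :=
  C.validB && P.gateFaceB C stub a 0 false && P.gateFaceB C stub a 0 true && P.gateFaceB C stub a 1 false &&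
    P.gateFaceB C stub a 1 true

/-- The gate table of a stub table. [folklore] -/
def gateOf (stub : Fin 2 → Bool → Option ℕ) (k : Fin 2) (s : Bool) : Bool := (stub k s).isSome

variable {P} {C : GateC} {stub : Fin 2 → Bool → Option ℕ} {a : ℚ}

/-- Validity of the template datum from the gate test. [folklore] -/
theorem validC_of_gateOKB (h : P.gateOKB C stub a = true) : C.validB = true := by
  simp only [gateOKB, Bool.and_eq_true] at h; exact h.1.1.1.1

/-- The face test from the gate test. [folklore] -/
theorem gateFaceB_of_gateOKB (h : P.gateOKB C stub a = true) (k : Fin 2) (s : Bool) : P.gateFaceB C stub a k s = true := by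
  simp only [gateOKB, Bool.and_eq_true] at h
  obtain ⟨⟨⟨⟨-, h1⟩, h2⟩, h3⟩, h4⟩ := h
  fin_cases k <;> cases s
  exacts [h1, h2, h3, h4]

/-- **Off the boxes on the face strips**: a point of a face strip which is away from the gate
window (or on a face without stub) lies in no support box, at any time. [folklore] -/
theorem not_mem_supp_of_gateOKB (h : P.gateOKB C stub a = true) (t : ℝ) {z : E²} {k : Fin 2} {s : Bool}
    (hz : |z k - faceValue s| < C.δ) (hw : stub k s = none ∨ (C.δ : ℝ) ≤ |z (GateC.oth k) - 1 / 2|) :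
    ∀ j < P.K, z ∉ ((P.node j).box.frzAt (clock P.T0 P.Tau t)).supp := by
  intro j hj hmem
  have hf := gateFaceB_of_gateOKB h k s
  have hC := validC_of_gateOKB h
  have hα := clock_mem_Icc P.T0 P.Tau t
  cases hst : stub k s with
  | none =>
    rw [gateFaceB, hst] at hf
    have := List.all_eq_true.1 hf j (List.mem_range.2 hj)
    exact BoxQ.not_strip_of_avoidStripB this hα hmem hz
  | some n =>
    rw [gateFaceB, hst] at hf
    simp only [Bool.and_eq_true, decide_eq_true_eq, List.all_eq_true, Bool.or_eq_true] at hf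
    obtain ⟨⟨⟨⟨⟨-, hall⟩, hbox⟩, -⟩, -⟩, -⟩ := hf
    rcases hall j (List.mem_range.2 hj) with hjn | hav
    · subst hjn
      have ht := BoxQ.transversal_of_stubBoxB hbox hC hmem
      rcases hw with hw | hw
      · rw [hst] at hw; cases hw
      · exact absurd ht (not_lt.2 hw)
    · exact BoxQ.not_strip_of_avoidStripB hav hα hmem hz

/-- **Vanishing on the face strips** away from the gate windows (all times). [folklore] -/
theorem vanish_of_gateOKB (hwf : P.chain.WFBd P.Band) (h : P.gateOKB C stub a = true) (G : ℝ → ℝ) (t : ℝ) {z : E²}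
    {k : Fin 2} {s : Bool} (hz : |z k - faceValue s| < C.δ)
    (hw : ¬ gateOf stub k s = true ∨ ∃ j, j ≠ k ∧ (C.δ : ℝ) ≤ |z j - 2⁻¹|) :
    P.velocity t z = 0 ∧ P.scalar G t z = 0 := by
  have hw' : stub k s = none ∨ (C.δ : ℝ) ≤ |z (GateC.oth k) - 1 / 2| := by
    rcases hw with hw | ⟨j, hjk, hj⟩
    · left; simpa [gateOf] using hw
    · right; rw [GateC.eq_oth_of_ne hjk] at hj; simpa [one_div] using hj
  have hoff := not_mem_supp_of_gateOKB h t hz hw'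
  exact ⟨hwf.velocity_eq_zero_off_boxes hoff, hwf.scalar_eq_zero_off_boxes hoff⟩

/-- The gate window of the face `(k, s)` with margin `δ`. [folklore] -/
def window (δ : ℝ) (k : Fin 2) (s : Bool) : Set E² :=
  {w | |w k - faceValue s| < δ ∧ |w (GateC.oth k) - 1 / 2| < 2 * δ}

/-- The gate window is open. [folklore] -/
theorem isOpen_window (δ : ℝ) (k : Fin 2) (s : Bool) : IsOpen (window δ k s) := by
  have h1 : Continuous fun w : E² => |w k - faceValue s| := ((EuclideanSpace.proj k).continuous.sub continuous_const).abs
  have h2 : Continuous fun w : E² => |w (GateC.oth k) - 1 / 2| :=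
    ((EuclideanSpace.proj (GateC.oth k)).continuous.sub continuous_const).abs
  exact (isOpen_lt h1 continuous_const).inter (isOpen_lt h2 continuous_const)

/-- The other coordinate of the gate-local position. [folklore] -/
theorem sub_faceMidpoint_oth (z : E²) (k : Fin 2) (s : Bool) : (z - faceMidpoint k s) (GateC.oth k) = z (GateC.oth k) - 1 / 2 := by
  rw [PiLp.sub_apply, faceMidpoint_apply, if_neg (GateC.oth_ne k), one_div]

/-- The normal coordinate of the gate-local position. [folklore] -/
theorem sub_faceMidpoint_self (z : E²) (k : Fin 2) (s : Bool) : (z - faceMidpoint k s) k = z k - faceValue s := by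
  rw [PiLp.sub_apply, faceMidpoint_apply, if_pos rfl]

/-- **The fields on a gate window** (times after the slot start): the assembled scalar is the
template scalar and the assembled velocity the template velocity, placed at the gate. [folklore] -/
theorem eq_gate_of_gateOKB (hwf : P.chain.WFBd P.Band) (hv : P.elemsValidB = true) (h : P.gateOKB C stub a = true)
    (G : ℝ → ℝ) {t : ℝ} (ht : (a : ℝ) ≤ t) {z : E²} {k : Fin 2} {s : Bool} {n : ℕ} (hst : stub k s = some n)
    (hz : |z k - faceValue s| < C.δ) (hzw : |z (GateC.oth k) - 1 / 2| < 2 * C.δ) :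
    P.scalar G t z = C.ΘgT G k t (z - faceMidpoint k s) ∧ P.velocity t z = C.VgT k t (z - faceMidpoint k s) := by
  have hf := gateFaceB_of_gateOKB h k s
  have hC := validC_of_gateOKB h
  rw [gateFaceB, hst] at hf
  simp only [Bool.and_eq_true, decide_eq_true_eq, List.all_eq_true, Bool.or_eq_true, Bool.not_eq_true',
    decide_eq_false_iff_not] at hf
  obtain ⟨⟨⟨⟨⟨hn, hall⟩, hbox⟩, hnode⟩, hout⟩, hin⟩ := hf
  -- the stub run
  rw [stubNodeB] at hnode
  cases he : (P.node n).e with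
  | dg d => rw [he] at hnode; exact Bool.noConfusion hnode
  | run r =>
  rw [he] at hnode
  simp only [Bool.and_eq_true] at hnode
  obtain ⟨⟨hfr, hgp⟩, hsc⟩ := hnode
  have hvr : r.validB = true := by have := validB_node hv hn; rwa [he] at this
  have hT : C.TimeOK (r.sqB C P.t₀ P.τ) t := RunQ.timeOK_of_schedB hsc hC ht
  -- the cut-offs on the window, at any time
  have hχ0 : ∀ (t' : ℝ) (w : E²), w ∈ window C.δ k s → ∀ j < P.K, j ≠ n → P.chain.chi j t' w = 0 := by
    intro t' w hw j hj hjn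
    rcases hall j (List.mem_range.2 hj) with hjn' | hav
    · exact absurd hjn' hjn
    · exact hwf.chi_eq_zero_of_not_mem hj fun hmem =>
        BoxQ.not_strip_of_avoidStripB hav (clock_mem_Icc P.T0 P.Tau t') hmem hw.1
  have hχn : ∀ (t' : ℝ) (w : E²), w ∈ window C.δ k s → P.chain.chi n t' w = C.pT (w (GateC.oth k) - 1 / 2) := by
    intro t' w hw
    rw [MovingChain.chi_apply, ChainData.chi_apply, MovingChain.frozen_B, chain_box, BoxQ.moving_frz,
      BoxQ.val_of_stubBoxB hbox hC (clock_mem_Icc _ _ _) hw.1]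
    have hin1 : (P.chain.frozen t').sigmaIn n t' w = 1 := by
      rw [ChainData.sigmaIn]
      split_ifs with h0
      · rfl
      · rcases hin with h0' | hin
        · exact absurd h0' h0
        · rw [ChainData.sigmaOut, if_pos (by simp; omega)]
          exact JStep.val_eq_one _ (StepQ.le_arg_of_inStepB hin _ _ _ hw.1 hw.2)
    have hout0 : (P.chain.frozen t').sigmaOut n t' w = 0 := by
      rw [ChainData.sigmaOut]
      split_ifs with h1
      · rcases hout with h1' | hout
        · exact absurd (by simpa using h1) h1'
        · exact JStep.val_eq_zero _ (StepQ.arg_le_of_outStepB hout _ _ _ hw.1 hw.2)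
      · rfl
    rw [hin1, hout0, sub_zero, mul_one]
  -- the element fields on the face strip at the time `t`
  have hel : ∀ w : E², |w k - faceValue s| < C.δ →
      P.Θ G n t w = G ((w (GateC.oth k) - 1 / 2) / C.Wt t) ∧ P.H n t w = C.ΨT k t (w - faceMidpoint k s) := by
    intro w hw
    have := RunQ.stub_fields hvr hfr hgp hsc hC G hT hw
    simp only [PhaseQ.Θ, PhaseQ.H, he, ElemQ.scalar, ElemQ.stream, PhaseQ.T0, PhaseQ.Tau]
    exact this
  have hzW : z ∈ window C.δ k s := ⟨hz, hzw⟩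
  constructor
  · -- scalar
    rw [PhaseQ.scalar, (assembled_single (H := P.H) hn (hχ0 t z hzW)).1, hχn t z hzW, (hel z hz).1, GateC.ΘgT_eq,
      sub_faceMidpoint_oth]
  · -- velocity
    have hev : ∀ᶠ p in 𝓝 (t, z), ∀ j < P.K, j ≠ n → P.chain.chi j p.1 p.2 = 0 :=
      eventually_of_mem_open (U := {p : ℝ × E² | p.2 ∈ window C.δ k s})
        (P := fun t' w => ∀ j < P.K, j ≠ n → P.chain.chi j t' w = 0) ((isOpen_window _ k s).preimage continuous_snd)
        (show (t, z) ∈ {p : ℝ × E² | p.2 ∈ window (C.δ : ℝ) k s} from hzW) fun p hp => hχ0 p.1 p.2 hp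
    rw [PhaseQ.velocity, assembledVelocity_single hn hev]
    have hloc : (fun w => P.chain.chi n t w * P.H n t w) =ᶠ[𝓝 z] fun w => C.HgT k t (w - faceMidpoint k s) := by
      filter_upwards [(isOpen_window (C.δ : ℝ) k s).mem_nhds hzW] with w hw
      rw [hχn t w hw, (hel w hw.1).2, GateC.HgT_eq, sub_faceMidpoint_oth]
    rw [perpGrad_congr hloc, perpGrad_comp_sub, GateC.VgT_eq_perpGrad]

/-- **Tangency on the faces** (times after the slot start): the normal velocity vanishes on the
four face lines. [folklore] -/
theorem tangent_of_gateOKB (hwf : P.chain.WFBd P.Band) (hv : P.elemsValidB = true) (h : P.gateOKB C stub a = true)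
    {t : ℝ} (ht : (a : ℝ) ≤ t) (z : E²) (j : Fin 2) (hj : z j = 0 ∨ z j = 1) : P.velocity t z j = 0 := by
  have hC := validC_of_gateOKB h
  have hδ := GateC.δ_pos hC
  -- the face through `z`
  obtain ⟨s, hs⟩ : ∃ s : Bool, z j = faceValue s := by
    rcases hj with hj | hj
    exacts [⟨false, by simp [hj]⟩, ⟨true, by simp [hj]⟩]
  have hz : |z j - faceValue s| < C.δ := by rw [hs, sub_self, abs_zero]; exact hδ
  by_cases hcase : gateOf stub j s = true ∧ |z (GateC.oth j) - 1 / 2| < C.δ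
  · obtain ⟨hg, hw⟩ := hcase
    obtain ⟨n, hst⟩ := Option.isSome_iff_exists.1 hg
    have hw2 : |z (GateC.oth j) - 1 / 2| < 2 * C.δ := by linarith
    rw [(eq_gate_of_gateOKB hwf hv h (fun _ => 0) ht hst hz hw2).2]
    exact GateC.VgT_tangent j t (by rw [sub_faceMidpoint_self, hs, sub_self])
  · have hw : ¬ gateOf stub j s = true ∨ ∃ i, i ≠ j ∧ (C.δ : ℝ) ≤ |z i - 2⁻¹| := by
      by_cases hg : gateOf stub j s = true
      · right
        refine ⟨GateC.oth j, GateC.oth_ne j, ?_⟩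
        have : ¬ |z (GateC.oth j) - 1 / 2| < C.δ := fun hw => hcase ⟨hg, hw⟩
        simpa [one_div] using not_lt.1 this
      · exact Or.inl hg
    rw [(vanish_of_gateOKB hwf h (fun _ => 0) t hz hw).1]
    rfl

end PhaseQ

end PlanarKinematics

end Literature.Analysis.FluidPDE
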